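import Literature.AnabelianGeometry.AbsoluteAnabelian.AbsAnabProp121viiSub
import Literature.NumberTheory.GaloisRepresentations.TateLevelOneLocalCharacters
import HarnessLib

/-!
# [AbsAnab] Prop 1.2.1 (vii), sub-DAG row L06a `ExistsNormalizedCocycle` — PROVED
# (the normalised unramified character `G_K → Gal(K^unr/K) ≅ Ẑ → ℤ/n`, `Frob ↦ 1`, as a cocycle)

S. Mochizuki, *The Absolute Anabelian Geometry of Hyperbolic Curves* (2004) [AbsAnab], §1.2 p. 10
(lit key paper:url-e8f118cc205e): "the Frobenius element" of `G_K^{ab}/Im(𝒪^×_K) ≅ Ẑ`; Prop 1.2.1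
(vii) p. 11, last arrow of the printed proof: `H²(Gal(K^unr/K), ℤ) = H²(Ẑ, ℤ) = ℚ/ℤ`.  The residue map
is normalised (row L05 `IsInvariantMap` of `AbsAnabProp121viiSub.lean`) against the unramified
character `χ : G_K → ℤ/n` that kills the inertia group and takes the value `1` on every arithmetic
Frobenius lift, viewed as the continuous crossed homomorphism `σ ↦ (χ σ)·id ∈ μ_n^∨(1)`
(`IsNormalizedUnramifiedCocycle`).  Row L06a of `plan/L4/SUBDAG-AbsAnab-Prop121vii.md`: SUCH A
COCYCLE EXISTS (`exists_isNormalizedUnramifiedCocycle`, `K : Type u`, valued MLF of characteristic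
`0`).

Construction (Serre, *Local Fields* IV §4 Prop. 16 and Cor.; XIII §4 App.): `ζ` a primitive
`(q^n - 1)`-th root of unity in `K̄` (tree `LocalWeilDatum.rootOfUnramifiedLevel`), `χ_N` the mod
`N = q^n - 1` cyclotomic character (tree `modNCyclotomicCharacter`; it kills `I_K`, and an arithmetic
Frobenius `φ` acts by `ζ ↦ ζ^q`, `LocalWeilDatum.smul_eq_pow_of_isFrobPow`); `Γ_K/I_K` being
procyclic generated by `φ` (`exists_zpow_eq_of_absInertia_le_ker`, density of the Weil group),
`χ_N(σ) = χ_N(φ)^{j(σ)}` with `j(σ)` well defined modulo `n` (`φ^k` fixes `ζ` iff `n ∣ k`,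
`LocalWeilDatum.smul_eq_self_iff_dvd_of_isFrobPow`), and `χ(σ) := j(σ) mod n`.
Proof-only (abc-iut seat w5-d198, sub-DAG holder; fallback for the L06 holder abc-iut-w5-d201, who may
re-derive it from a `CyclicCharacter`); theorems only, no definitions; nothing here bears on [IUTchIII] Cor. 3.12.
-/

noncomputable section

universe u

namespace Literature.AnabelianGeometry.AbsoluteAnabelian

namespace Prop121vii

open Field ValuativeRel
open Literature.NumberTheory.GaloisRepresentations
open Literature.NumberTheory.GaloisRepresentations.DiscreteGaloisModule
open Literature.NumberTheory.GaloisRepresentations.IsNonarchimedeanLocalField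

section ScalarEndos

variable (K : Type u) [Field K] (n : ℕ)

/-- Scalars act the same way modulo `n` on `μ_n` (additive carrier): `n • m = 0`. [folklore] -/
private theorem zsmul_toAdditive_eq_of_intCast_eq {a b : ℤ} (h : (a : ZMod n) = b)
    (m : MuCarrier K n) :
    a • MuCarrier.toAdditive m = b • MuCarrier.toAdditive m := by
  obtain ⟨c, hc⟩ := (ZMod.intCast_eq_intCast_iff_dvd_sub a b n).1 h
  have hb : b = a + n * c := by linarith
  have h0 : (n : ℤ) • MuCarrier.toAdditive m = 0 := zsmul_muCarrier_eq_zero K n m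
  rw [hb, add_zsmul, mul_comm, mul_zsmul, h0, zsmul_zero, add_zero]

/-- The multiple `a · id` of the identity of `μ_n`, an element of the Tate dual
`μ_n^∨(1) = Hom(μ_n, μ_n)` (as the additive map `m ↦ a • m`), only depends on `a` modulo `n`.
[folklore] -/
private theorem scalarHom_eq_of_intCast_eq {a b : ℤ} (h : (a : ZMod n) = b) :
    (((zsmulAddGroupHom a : Additive (rootsOfUnity n (AlgebraicClosure K)) →+ Additive (rootsOfUnity n (AlgebraicClosure K)))).comp
        (MuCarrier.toAdditive (K := K) (n := n)).toAddMonoidHom : TateDual K (MuCarrier K n) n) =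
      ((zsmulAddGroupHom b : Additive (rootsOfUnity n (AlgebraicClosure K)) →+ Additive (rootsOfUnity n (AlgebraicClosure K)))).comp
        (MuCarrier.toAdditive (K := K) (n := n)).toAddMonoidHom :=
  TateDual.ext fun m => zsmul_toAdditive_eq_of_intCast_eq K n h m

/-- Additivity of `a ↦ a · id`. [folklore] -/
private theorem scalarHom_add (a b : ℤ) :
    (((zsmulAddGroupHom (a + b) : Additive (rootsOfUnity n (AlgebraicClosure K)) →+ Additive (rootsOfUnity n (AlgebraicClosure K)))).comp
        (MuCarrier.toAdditive (K := K) (n := n)).toAddMonoidHom : TateDual K (MuCarrier K n) n) =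
      ((zsmulAddGroupHom a : Additive (rootsOfUnity n (AlgebraicClosure K)) →+ Additive (rootsOfUnity n (AlgebraicClosure K)))).comp
          (MuCarrier.toAdditive (K := K) (n := n)).toAddMonoidHom +
        ((zsmulAddGroupHom b : Additive (rootsOfUnity n (AlgebraicClosure K)) →+ Additive (rootsOfUnity n (AlgebraicClosure K)))).comp
          (MuCarrier.toAdditive (K := K) (n := n)).toAddMonoidHom :=
  TateDual.ext fun m => add_zsmul (MuCarrier.toAdditive m) a b

/-- `G_K` acts trivially on the multiples of the identity in `μ_n^∨(1)`. [folklore] -/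
private theorem tateDual_scalarHom [Finite (MuCarrier K n)] (σ : absoluteGaloisGroup K) (a : ℤ) :
    (mu K n).tateDual n σ
        (((zsmulAddGroupHom a : Additive (rootsOfUnity n (AlgebraicClosure K)) →+ Additive (rootsOfUnity n (AlgebraicClosure K)))).comp
          (MuCarrier.toAdditive (K := K) (n := n)).toAddMonoidHom) =
      ((zsmulAddGroupHom a : Additive (rootsOfUnity n (AlgebraicClosure K)) →+ Additive (rootsOfUnity n (AlgebraicClosure K)))).comp
        (MuCarrier.toAdditive (K := K) (n := n)).toAddMonoidHom := by
  refine TateDual.ext fun m => ?_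
  rw [tateDual_apply_apply_apply]
  change (mu K n σ) (a • (mu K n σ⁻¹) m) = a • m
  rw [map_zsmul, ← Module.End.mul_apply, ← _root_.map_mul, mul_inv_cancel, _root_.map_one,
    Module.End.one_apply]

end ScalarEndos

section Existence

variable (K : Type u) [Field K] [ValuativeRel K] [TopologicalSpace K] [IsNonarchimedeanLocalField K]

/-- **Row L06a `ExistsNormalizedCocycle` — PROVED**: for an MLF `K` (valued form, characteristic
`0`) and `n ≥ 1`, the normalised unramified cocycle exists: a continuous crossed homomorphism
`g : G_K → μ_n^∨(1)` with `g σ = (χ σ)·id`, `χ` killing `I_K` and equal to `1` on every arithmetic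
Frobenius lift ([AbsAnab] §1.2 p. 10 "the Frobenius element"; Serre, *Local Fields* IV §4 Prop. 16,
XIII §4 App.). [cite: MochizukiAbsAnab2004, §1.2 p.10] -/
theorem exists_isNormalizedUnramifiedCocycle [CharZero K] (n : ℕ) [NeZero n]
    [Finite (MuCarrier K n)] :
    ∃ g : contOneCocycles ((mu K n).tateDual n).toTopRep, IsNormalizedUnramifiedCocycle K n g := by
  classical
  have hn : 0 < n := NeZero.pos n
  -- an arithmetic Frobenius
  obtain ⟨φ, hφ⟩ := exists_isAbsArithFrob_holds K
  have hφ1 : IsFrobPow φ 1 := IsAbsArithFrob.isFrobPow_holds hφ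
  -- the level `N = q ^ n - 1`, a primitive `N`-th root of unity and the mod `N` cyclotomic character
  obtain ⟨N, hN_def⟩ : ∃ N : ℕ, N = residueFieldCard K ^ n - 1 := ⟨_, rfl⟩
  have hN0 : N ≠ 0 := hN_def ▸ LocalWeilDatum.residueFieldCard_pow_sub_one_ne_zero K n hn
  have hpN : ¬ ringChar 𝓀[K] ∣ N :=
    hN_def ▸ LocalWeilDatum.not_ringChar_dvd_residueFieldCard_pow_sub_one K hn
  haveI : NeZero N := ⟨hN0⟩
  haveI : NeZero ((N : ℕ) : K) := ⟨hN_def ▸ natCast_residueFieldCard_pow_sub_one_ne_zero K hn.ne'⟩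
  set ζ : AlgebraicClosure K := LocalWeilDatum.rootOfUnramifiedLevel K n with hζ_def
  have hζ : IsPrimitiveRoot ζ N :=
    hN_def ▸ LocalWeilDatum.isPrimitiveRoot_rootOfUnramifiedLevel K hn
  set χ : absoluteGaloisGroup K →* (ZMod N)ˣ := modNCyclotomicCharacter K N with hχ_def
  -- `χ` kills inertia
  have hχI : ∀ σ ∈ absInertia K, χ σ = 1 := fun σ hσ => by
    have hfix : σ • ζ = ζ :=
      smul_eq_self_of_pow_eq_one_of_mem_absInertia hσ (Nat.pos_of_ne_zero hN0) hpN hζ.pow_eq_one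
    ext
    have h1 := modNCyclotomicCharacter_eq_of_smul_eq_pow K N hζ σ (c := 1) (by rw [pow_one, hfix])
    rw [hχ_def, h1, Units.val_one, Nat.cast_one]
  -- Frobenius lifts all have the same value under `χ`
  have hχF : ∀ σ : absoluteGaloisGroup K, IsFrobPow σ 1 → χ σ = χ φ := fun σ hσ => by
    have e1 : σ • ζ = ζ ^ residueFieldCard K ^ 1 :=
      LocalWeilDatum.smul_eq_pow_of_isFrobPow K hpN hN0 (k := 1) (by simpa using hσ) hζ.pow_eq_one
    have e2 : φ • ζ = ζ ^ residueFieldCard K ^ 1 :=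
      LocalWeilDatum.smul_eq_pow_of_isFrobPow K hpN hN0 (k := 1) (by simpa using hφ1) hζ.pow_eq_one
    ext
    rw [modNCyclotomicCharacter_eq_of_smul_eq_pow K N hζ σ e1,
      modNCyclotomicCharacter_eq_of_smul_eq_pow K N hζ φ e2]
  -- `χ (φ ^ k) = 1 → n ∣ k`
  have hχφ : ∀ k : ℕ, χ (φ ^ k) = 1 → n ∣ k := fun k hk => by
    have hσk : IsFrobPow (φ ^ k) (k : ℤ) := by simpa using hφ1.pow k
    have hsmul : (φ ^ k) • ζ = ζ := by
      have h1 := modNCyclotomicCharacter_spec K N (φ ^ k) ζ hζ.pow_eq_one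
      rw [← hχ_def, hk, Units.val_one, ZMod.val_one_eq_one_mod] at h1
      rw [h1]
      conv_rhs => rw [← pow_one ζ, ← Nat.mod_add_div 1 N, pow_add, pow_mul, hζ.pow_eq_one,
        one_pow, mul_one]
    exact (LocalWeilDatum.smul_eq_self_iff_dvd_of_isFrobPow K hn (hN_def ▸ hζ) hσk).mp hsmul
  have hχφz : ∀ z : ℤ, χ φ ^ z = 1 → (n : ℤ) ∣ z := fun z hz => by
    rw [← map_zpow] at hz
    obtain ⟨k, rfl | rfl⟩ := z.eq_nat_or_neg
    · rw [zpow_natCast] at hz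
      exact Int.natCast_dvd_natCast.mpr (hχφ k hz)
    · rw [zpow_neg, zpow_natCast, map_inv, inv_eq_one] at hz
      exact (dvd_neg).mpr (Int.natCast_dvd_natCast.mpr (hχφ k hz))
  -- the kernel of `χ` is open and contains the inertia group
  have hχker : ((χ.ker : Subgroup _) : Set (absoluteGaloisGroup K)) ∈
      nhds (1 : absoluteGaloisGroup K) := by
    have hev := modNCyclotomicCharacter_eventually_eq_one K N
    rw [Filter.Eventually] at hev
    exact hev
  have hker : IsOpen ((χ.ker : Subgroup _) : Set (absoluteGaloisGroup K)) :=
    Subgroup.isOpen_of_mem_nhds _ hχker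
  have hIker : absInertia K ≤ χ.ker := fun σ hσ => by
    rw [MonoidHom.mem_ker]; exact hχI σ hσ
  -- every `σ` is `φ ^ j` through `χ`, `j` well defined modulo `n`
  have hgen : ∀ σ, ∃ j : ℤ, χ σ = χ φ ^ j := exists_zpow_eq_of_absInertia_le_ker K χ hker hIker hφ
  choose j hj using hgen
  have hwd : ∀ {a b : ℤ}, χ φ ^ a = χ φ ^ b → ((a : ZMod n) = (b : ZMod n)) := by
    intro a b h
    rw [ZMod.intCast_eq_intCast_iff_dvd_sub]
    refine hχφz _ ?_
    rw [zpow_sub, ← h, mul_inv_cancel]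
  -- the cocycle `g σ := j σ · id`
  let gfun : absoluteGaloisGroup K → TateDual K (MuCarrier K n) n := fun σ =>
    ((zsmulAddGroupHom (j σ) : Additive (rootsOfUnity n (AlgebraicClosure K)) →+ Additive (rootsOfUnity n (AlgebraicClosure K)))).comp
      (MuCarrier.toAdditive (K := K) (n := n)).toAddMonoidHom
  have hgmul : ∀ σ u, u ∈ χ.ker → gfun (σ * u) = gfun σ := fun σ u hu =>
    scalarHom_eq_of_intCast_eq K n
      (hwd (a := j (σ * u)) (b := j σ) (by rw [← hj, ← hj, map_mul, show χ u = 1 from hu, mul_one]))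
  have hgcont : Continuous gfun :=
    (isLocallyConstant_of_mul_mem gfun χ.ker hker hgmul).continuous
  have hgadd : ∀ σ τ, gfun (σ * τ) = gfun σ + gfun τ := fun σ τ =>
    (scalarHom_eq_of_intCast_eq K n (a := j (σ * τ)) (b := j σ + j τ)
      (hwd (a := j (σ * τ)) (b := j σ + j τ)
        (by rw [← hj, map_mul, hj σ, hj τ, zpow_add]))).trans (scalarHom_add K n (j σ) (j τ))
  let g : contOneCocycles ((mu K n).tateDual n).toTopRep :=
    ⟨⟨gfun, hgcont⟩, fun σ τ => by
      change gfun (σ * τ) = gfun σ + (mu K n).tateDual n σ (gfun τ)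
      rw [hgadd]
      congr 1
      exact (tateDual_scalarHom K n σ (j τ)).symm⟩
  refine ⟨g, fun σ => (j σ : ZMod n), fun σ m => ?_, fun σ hσ => ?_, fun σ hσ => ?_⟩
  · -- `g σ m = (j σ mod n)·m`
    change (gfun σ) m = _
    change j σ • MuCarrier.toAdditive m = _
    exact zsmul_toAdditive_eq_of_intCast_eq K n (by rw [Int.cast_natCast, ZMod.natCast_zmod_val]) m
  · -- inertia: `χ σ = 1 = χ φ ^ 0`
    rw [← Int.cast_zero]
    exact hwd (by rw [← hj, zpow_zero]; exact hχI σ hσ)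
  · -- Frobenius lifts: `χ σ = χ φ = χ φ ^ 1`
    rw [← Int.cast_one]
    exact hwd (by rw [← hj, zpow_one]; exact hχF σ hσ)

end Existence

end Prop121vii

end Literature.AnabelianGeometry.AbsoluteAnabelian
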